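import Literature.NumberTheory.EllipticCurves.ZpExtensionGaloisTwistLevel
import Literature.NumberTheory.EllipticCurves.Kobayashi2003.SignedSelmer
import HarnessLib

/-!
# The local Kummer condition cut out by a subgroup of points on `H¹(Γ_{K_v}, E[p^J](χ_u))`:
# the class-level LOCAL form of Kobayashi's `±`/Kummer conditions for the twisted torsion modules
# (definition with body + unfolding lemmas + the bridge to `localKummerOverOfEmb`)

Topic `NumberTheory/EllipticCurves` (next to `ZpExtensionGaloisTwistLocal`, `ZpExtensionGaloisTwistLevel`,
`Kobayashi2003.SignedSelmer`); namespace `WeierstrassCurve`. ONE DEFINITION WITH BODY + theorems; no named fact,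
no instance, no notation.

Kobayashi (Invent. math. 152 (2003), Def. 1.1): «We regard `E(K_{n,v}) ⊗ ℚ_p/ℤ_p` as a subgroup of
`H¹(K_{n,v}, E[p^∞])` by the Kummer map … `Sel^±(E/K_n)` is the set of classes whose local image at the prime
above `p` lies in `E^±(K_{n,v}) ⊗ ℚ_p/ℤ_p`.» In the tree this condition exists only for GLOBAL classes over
`K_∞` (`Kobayashi2003.localKummerOverOfEmb W p H ι A ≤ W.subgroupH1 p H`: the classes `c = [φ]` with
`ι(φ(τ|_{K̄})) = τ•Q − Q` on `Gal(K̄_E/(K_∞)_w)` for a point `Q ∈ E(K̄_E)` with `p^k Q ∈ A`). Greenberg's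
twisted descent at finite level (LNM 1716, §4 pp. 122–124, with the modules `A_s[p^J] = E[p^J](χ_u)`,
`W.twistedTorsionGaloisModule`) is a Poitou–Tate argument over the NUMBER FIELD `K`, whose Selmer structures
(`DiscreteGaloisModule.SelmerStructure`, file `PoitouTateSelmerStructures`) are families of LOCAL conditions
`𝓛_v ≤ H¹(Γ_{K_v}, E[p^J](χ_u))`. This file supplies the local condition at `v ∣ p` for Kobayashi's signed
Selmer groups (and, with `A = ⊤`, for the ordinary Kummer condition of `ZpExtensionGaloisTwistSelmerStructure`):

* `W.twistedTorsionLocalKummer p κ J u hu E A ≤ H¹(Γ_E, E[p^J](χ_u)|_{Γ_E})` (`E` a completion of `K`, `A` a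
  subgroup of `E(K̄_E)`, meant: `A = ⨆ₙ E^±((K_n)_w)`): the classes `y = [ψ]` with
  `pointsMap (ψ τ) = τ•Q − Q` for all `τ ∈ Gal(K̄_E/(K_∞)_w)` (`localSubgroup (ker κ) E`), for some `Q ∈ E(K̄_E)`
  with `p^k • Q ∈ A` for some `k` — the restriction of `y` to `(K_∞)_w` (where the twist is invisible) is the
  Kummer class of `p^k Q ⊗ p^{-k} ∈ A ⊗ ℚ_p/ℤ_p`;
* unfolding, monotonicity in `A`; every such class dies in `H¹((K_∞)_w, E(K̄_E))`
  (`twistedTorsionLocalKummer_le_ker`), and for `A = ⊤` the condition IS the kernel of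
  `twistedTorsionToLocalH1` (`twistedTorsionLocalKummer_top`), the local condition at `v ∣ p` of
  `W.twistedKummerSelmerStructure`;
* **the bridge** `twistedTorsionToH1_mem_localKummerOverOfEmb_iff`: for a GLOBAL class
  `x ∈ H¹(Γ_K, E[p^J](χ_u))`, its image `twistedTorsionToH1 x ∈ H¹(K_∞, E[p^∞])` satisfies Kobayashi's condition
  `localKummerOverOfEmb W p (ker κ) (closureEmb E) A` iff its localisation `res_E x` lies in
  `twistedTorsionLocalKummer … E A` (same point `Q` up to a torsion point coming from the change of cocycle
  representative);
* compatibility with the change of level `ι : E[p^j](χ_u) ↪ E[p^J](χ_u)` (`map_incl_mem_twistedTorsionLocalKummer`).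

References: S. Kobayashi, Invent. math. 152 (2003), Def. 1.1 [Kobayashi2003]; R. Greenberg, LNM 1716 (1999), §4
pp. 105–108, 122–124 [GreenbergLNM1716]; J.-P. Serre, *Galois Cohomology* (1997), I §2.4, II §1.1
[SerreGaloisCohomology1997].
-/

noncomputable section

open CategoryTheory Field
open scoped ContRepresentation

universe u

namespace WeierstrassCurve

open Literature.NumberTheory.EllipticCurves Literature.NumberTheory.GaloisRepresentations
  Literature.NumberTheory.EllipticCurves.Kobayashi2003

variable {K : Type u} [Field K] (W : WeierstrassCurve K) (p : ℕ) [Fact p.Prime]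
  (κ : ZpExtension K p) (J : ℕ) (u : ℤ) (hu : (p : ℤ) ∣ u - 1)
  (E : Type u) [Field E] [Algebra K E]

/-- **The local Kummer condition cut out by `A ⊆ E(K̄_E)` on `H¹(Γ_E, E[p^J](χ_u))`** (Kobayashi's
«`E^±(K_{n,v}) ⊗ ℚ_p/ℤ_p ⊂ H¹(K_{n,v}, E[p^∞])` by the Kummer map», read for the twisted module at a completion `E`
of `K`): the classes `y = [ψ]` such that on the local subgroup `Gal(K̄_E/(K_∞)_w)` (where `χ_u` is trivial)
`pointsMap (ψ τ) = τ•Q − Q` for a point `Q ∈ E(K̄_E)` with `p^k • Q ∈ A` for some `k`. An additive subgroup.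
[cite: Kobayashi2003, Def. 1.1] [cite: GreenbergLNM1716, §4 p. 124] -/
def twistedTorsionLocalKummer (A : AddSubgroup (localPoints W E)) :
    AddSubgroup (galoisCohomology ((W.twistedTorsionGaloisModule p κ J u hu).restrictField E) 1) where
  carrier := {y | ∃ (ψ : contOneCocycles ((W.twistedTorsionGaloisModule p κ J u hu).restrictField E).toTopRep)
      (Q : localPoints W E) (k : ℕ), oneCocycleClass _ ψ = y ∧ p ^ k • Q ∈ A ∧
      ∀ τ : localSubgroup κ.kerSubgroup E,
        pointsMap W E ((ψ.1 (τ : absoluteGaloisGroup E) : W.geomTorsion ((p ^ J : ℕ) : ℤ)) : W.geomPoints) =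
          (τ : absoluteGaloisGroup E) • Q - Q}
  zero_mem' := ⟨0, 0, 0, oneCocycleClass_zero _, by rw [smul_zero]; exact zero_mem A, fun τ ↦ by
    rw [smul_zero, sub_zero]; exact map_zero _⟩
  add_mem' := by
    rintro y₁ y₂ ⟨ψ₁, Q₁, k₁, rfl, hA₁, h₁⟩ ⟨ψ₂, Q₂, k₂, rfl, hA₂, h₂⟩
    refine ⟨ψ₁ + ψ₂, Q₁ + Q₂, k₁ + k₂, oneCocycleClass_add _ ψ₁ ψ₂, ?_, fun τ ↦ ?_⟩
    · rw [smul_add]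
      refine add_mem ?_ ?_
      · rw [pow_add, mul_comm, mul_smul]; exact AddSubgroup.nsmul_mem A hA₁ _
      · rw [pow_add, mul_smul]; exact AddSubgroup.nsmul_mem A hA₂ _
    · rw [Submodule.coe_add, ContinuousMap.add_apply, AddSubgroup.coe_add, map_add, h₁ τ, h₂ τ, smul_add]
      abel
  neg_mem' := by
    rintro y ⟨ψ, Q, k, rfl, hA, h⟩
    refine ⟨-ψ, -Q, k, ?_, by rw [smul_neg]; exact neg_mem hA, fun τ ↦ ?_⟩
    · change oneCocycleClassₗ _ (-ψ) = -oneCocycleClassₗ _ ψ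
      exact map_neg _ ψ
    · rw [Submodule.coe_neg, ContinuousMap.neg_apply, AddSubgroup.coe_neg, map_neg, h τ, smul_neg]
      abel

variable {W p κ J u hu E}

/-- Membership in the local Kummer condition (unfolding). [cite: Kobayashi2003, Def. 1.1] -/
theorem mem_twistedTorsionLocalKummer_iff (A : AddSubgroup (localPoints W E))
    (y : galoisCohomology ((W.twistedTorsionGaloisModule p κ J u hu).restrictField E) 1) :
    y ∈ W.twistedTorsionLocalKummer p κ J u hu E A ↔
      ∃ (ψ : contOneCocycles ((W.twistedTorsionGaloisModule p κ J u hu).restrictField E).toTopRep)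
        (Q : localPoints W E) (k : ℕ), oneCocycleClass _ ψ = y ∧ p ^ k • Q ∈ A ∧
        ∀ τ : localSubgroup κ.kerSubgroup E,
          pointsMap W E ((ψ.1 (τ : absoluteGaloisGroup E) : W.geomTorsion ((p ^ J : ℕ) : ℤ)) : W.geomPoints) =
            (τ : absoluteGaloisGroup E) • Q - Q :=
  Iff.rfl

/-- The local Kummer condition is monotone in `A`. [cite: Kobayashi2003, Def. 1.1] -/
theorem twistedTorsionLocalKummer_mono {A B : AddSubgroup (localPoints W E)} (h : A ≤ B) :
    W.twistedTorsionLocalKummer p κ J u hu E A ≤ W.twistedTorsionLocalKummer p κ J u hu E B := by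
  rintro y ⟨ψ, Q, k, hy, hA, hτ⟩
  exact ⟨ψ, Q, k, hy, h hA, hτ⟩

/-- Every class of the local Kummer condition dies in `H¹((K_∞)_w, E(K̄_E))`: its image under
`twistedTorsionToLocalH1` is the class of the coboundary `τ ↦ τ•Q − Q`. [cite: GreenbergLNM1716, §4 p. 124] -/
theorem twistedTorsionLocalKummer_le_ker (A : AddSubgroup (localPoints W E)) :
    W.twistedTorsionLocalKummer p κ J u hu E A ≤ (W.twistedTorsionToLocalH1 p κ J u hu E).ker := by
  rintro y ⟨ψ, Q, k, rfl, -, hτ⟩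
  rw [AddMonoidHom.mem_ker, twistedTorsionToLocalH1_oneCocycleClass, oneCocycleClass_eq_zero_iff]
  exact ⟨Q, fun τ ↦ hτ τ⟩

/-- For `A = ⊤` (no condition on the point) the local Kummer condition IS the kernel of
`twistedTorsionToLocalH1` — the local condition at `v ∣ p` of `W.twistedKummerSelmerStructure`
(`ZpExtensionGaloisTwistSelmerStructure`). [cite: GreenbergLNM1716, §4 pp. 107, 124] -/
theorem twistedTorsionLocalKummer_top :
    W.twistedTorsionLocalKummer p κ J u hu E ⊤ = (W.twistedTorsionToLocalH1 p κ J u hu E).ker := by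
  refine le_antisymm (W.twistedTorsionLocalKummer_le_ker ⊤) fun y hy ↦ ?_
  obtain ⟨ψ, rfl⟩ := oneCocycleClass_surjective _ y
  rw [AddMonoidHom.mem_ker, twistedTorsionToLocalH1_oneCocycleClass, oneCocycleClass_eq_zero_iff] at hy
  obtain ⟨Q, hQ⟩ := hy
  exact ⟨ψ, Q, 0, rfl, AddSubgroup.mem_top _, fun τ ↦ hQ τ⟩

/-- Change of level: `H¹(ι|_{Γ_E})` maps the local Kummer condition of level `j` into that of level `J ≥ j`
(same point `Q`; `ι` is the identity on points of `E(K̄)`). [cite: GreenbergLNM1716, §4 p. 124] -/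
theorem map_incl_mem_twistedTorsionLocalKummer {j : ℕ} (hjJ : j ≤ J) (A : AddSubgroup (localPoints W E))
    {y : galoisCohomology ((W.twistedTorsionGaloisModule p κ j u hu).restrictField E) 1}
    (hy : y ∈ W.twistedTorsionLocalKummer p κ j u hu E A) :
    galoisCohomology.map ((W.twistedTorsionIncl p κ hjJ u hu).restrictField E) 1 y ∈
      W.twistedTorsionLocalKummer p κ J u hu E A := by
  obtain ⟨ψ, Q, k, rfl, hA, hτ⟩ := hy
  rw [galoisCohomology.map_one_oneCocycleClass]
  exact ⟨_, Q, k, rfl, hA, fun τ ↦ hτ τ⟩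

omit [Fact p.Prime] in
/-- A geometric `p`-power-torsion point is killed by some `p^n`. [folklore] -/
private theorem exists_pow_smul_eq_zero_geomPrimaryTorsion (t : W.geomPrimaryTorsion p) :
    ∃ n : ℕ, p ^ n • t = 0 := by
  obtain ⟨n, hn⟩ := (AddCommGroup.mem_primaryComponent).mp t.2
  exact ⟨n, Subtype.ext (by rw [AddSubgroupClass.coe_nsmul, hn, ZeroMemClass.coe_zero])⟩

/-- **The bridge to Kobayashi's condition on global classes.** For `x ∈ H¹(Γ_K, E[p^J](χ_u))` and a subgroup
`A ⊆ E(K̄_E)`: the image `twistedTorsionToH1 x ∈ H¹(K_∞, E[p^∞])` lies in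
`localKummerOverOfEmb W p (ker κ) (closureEmb E) A` iff the localisation `res_E x ∈ H¹(Γ_E, E[p^J](χ_u))` lies in
`twistedTorsionLocalKummer … E A`. Both sides say: on `Gal(K̄_E/(K_∞)_w)` a cocycle representative is `τ ↦ τ•Q − Q`
read in `E(K̄_E)` with `p^k Q ∈ A`; a change of representative (a coboundary of a torsion point `t`) is absorbed by
`Q ↦ Q − t`, `k ↦ k + (exponent of t)`. [cite: Kobayashi2003, Def. 1.1] [cite: GreenbergLNM1716, §4 p. 124] -/
theorem twistedTorsionToH1_mem_localKummerOverOfEmb_iff (A : AddSubgroup (localPoints W E))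
    (x : galoisCohomology (W.twistedTorsionGaloisModule p κ J u hu) 1) :
    W.twistedTorsionToH1 p κ J u hu x ∈ localKummerOverOfEmb W p κ.kerSubgroup (closureEmb (K := K) E) A ↔
      galoisCohomology.res (W.twistedTorsionGaloisModule p κ J u hu) E 1 x ∈
        W.twistedTorsionLocalKummer p κ J u hu E A := by
  obtain ⟨ξ, rfl⟩ := oneCocycleClass_surjective _ x
  rw [twistedTorsionToH1_oneCocycleClass, galoisCohomology.res_oneCocycleClass, mem_localKummerOverOfEmb_iff,
    mem_twistedTorsionLocalKummer_iff]
  constructor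
  · rintro ⟨φ, Q, k, hφ, hA, hτ⟩
    -- `φ` and the pushed restriction of `ξ` differ by the coboundary of a torsion point `t`
    rw [← sub_eq_zero, ← oneCocycleClass_sub, oneCocycleClass_eq_zero_iff] at hφ
    obtain ⟨t, ht⟩ := hφ
    obtain ⟨n, hn⟩ := W.exists_pow_smul_eq_zero_geomPrimaryTorsion (p := p) t
    have ht0 : p ^ (k + n) • pointsMap W E (t : W.geomPoints) = 0 := by
      rw [pow_add, mul_smul, ← map_nsmul, ← AddSubgroupClass.coe_nsmul, hn, ZeroMemClass.coe_zero, map_zero,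
        smul_zero]
    refine ⟨_, Q - pointsMap W E (t : W.geomPoints), k + n, rfl, ?_, fun τ ↦ ?_⟩
    · rw [smul_sub, ht0, sub_zero, pow_add, mul_comm, mul_smul]
      exact AddSubgroup.nsmul_mem A hA _
    · -- the values on the local subgroup, read in `E(K̄_E)`
      have e1 : pointsMap W E ((φ.1 (resGalSubgroupOfEmb κ.kerSubgroup (closureEmb (K := K) E) τ) :
            W.geomPrimaryTorsion p) : W.geomPoints) -
          pointsMap W E ((ξ.1 (resGal (K := K) E (τ : absoluteGaloisGroup E)) :
            W.geomTorsion ((p ^ J : ℕ) : ℤ)) : W.geomPoints) =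
          (τ : absoluteGaloisGroup E) • pointsMap W E (t : W.geomPoints) - pointsMap W E (t : W.geomPoints) := by
        have h := congrArg (fun z : W.geomPrimaryTorsion p ↦ pointsMap W E (z : W.geomPoints))
          (ht (resGalSubgroupOfEmb κ.kerSubgroup (closureEmb (K := K) E) τ))
        simp only [ContinuousMap.sub_apply, AddSubgroupClass.coe_sub, map_sub] at h
        rw [← pointsMap_smul]
        exact h
      have e2 : pointsMap W E ((φ.1 (resGalSubgroupOfEmb κ.kerSubgroup (closureEmb (K := K) E) τ) :
          W.geomPrimaryTorsion p) : W.geomPoints) = (τ : absoluteGaloisGroup E) • Q - Q := hτ τ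
      change pointsMap W E ((ξ.1 (resGal (K := K) E (τ : absoluteGaloisGroup E)) :
          W.geomTorsion ((p ^ J : ℕ) : ℤ)) : W.geomPoints) = _
      rw [sub_eq_iff_eq_add] at e1
      rw [e1] at e2
      calc pointsMap W E ((ξ.1 (resGal (K := K) E (τ : absoluteGaloisGroup E)) :
              W.geomTorsion ((p ^ J : ℕ) : ℤ)) : W.geomPoints)
          = ((τ : absoluteGaloisGroup E) • Q - Q) -
              ((τ : absoluteGaloisGroup E) • pointsMap W E (t : W.geomPoints) - pointsMap W E (t : W.geomPoints)) := by
            rw [← e2]; abel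
        _ = _ := by rw [smul_sub]; abel
  · rintro ⟨ψ, Q, k, hψ, hA, hτ⟩
    -- `ψ` and the restriction of `ξ` differ by the coboundary of a point `m ∈ E[p^J]`
    rw [← sub_eq_zero, ← oneCocycleClass_sub, oneCocycleClass_eq_zero_iff] at hψ
    obtain ⟨m, hm⟩ := hψ
    have hm0 : p ^ (k + J) • pointsMap W E (m : W.geomPoints) = 0 := by
      rw [pow_add, mul_smul, ← map_nsmul, ← AddSubgroupClass.coe_nsmul, W.pow_nsmul_geomTorsion_pow p J m,
        ZeroMemClass.coe_zero, map_zero, smul_zero]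
    refine ⟨_, Q - pointsMap W E (m : W.geomPoints), k + J, rfl, ?_, fun τ ↦ ?_⟩
    · rw [smul_sub, hm0, sub_zero, pow_add, mul_comm, mul_smul]
      exact AddSubgroup.nsmul_mem A hA _
    · have hτker : resGal (K := K) E (τ : absoluteGaloisGroup E) ∈ κ.kerSubgroup :=
        (mem_localSubgroup_iff κ.kerSubgroup E _).mp τ.2
      -- the twisted action of `τ` on `m` is the plain Galois action (`τ|_{K̄} ∈ ker κ`)
      have hact : ((((W.twistedTorsionGaloisModule p κ J u hu).restrictField E).toTopRep.ρ
            (τ : absoluteGaloisGroup E) m : W.geomTorsion ((p ^ J : ℕ) : ℤ)) : W.geomPoints) =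
          resGal (K := K) E (τ : absoluteGaloisGroup E) • (m : W.geomPoints) := by
        change ((W.twistedTorsionGaloisModule p κ J u hu (resGal (K := K) E (τ : absoluteGaloisGroup E)) m :
            W.geomTorsion ((p ^ J : ℕ) : ℤ)) : W.geomPoints) = _
        rw [ZpExtension.galoisTwist_apply_of_mem_kerSubgroup _ _ _ _ _ _ hτker, torsionGaloisModule_apply_apply,
          Literature.NumberTheory.EllipticCurves.AddSubgroup.torsionBy.coe_smul]
      have e1 : pointsMap W E ((ψ.1 (τ : absoluteGaloisGroup E) : W.geomTorsion ((p ^ J : ℕ) : ℤ)) : W.geomPoints) -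
          pointsMap W E ((ξ.1 (resGal (K := K) E (τ : absoluteGaloisGroup E)) :
            W.geomTorsion ((p ^ J : ℕ) : ℤ)) : W.geomPoints) =
          (τ : absoluteGaloisGroup E) • pointsMap W E (m : W.geomPoints) - pointsMap W E (m : W.geomPoints) := by
        have h := congrArg (fun z : W.geomTorsion ((p ^ J : ℕ) : ℤ) ↦ pointsMap W E (z : W.geomPoints))
          (hm (τ : absoluteGaloisGroup E))
        simp only [ContinuousMap.sub_apply, AddSubgroupClass.coe_sub, map_sub] at h
        rw [hact, pointsMap_smul] at h
        exact h
      have e2 : pointsMap W E ((ψ.1 (τ : absoluteGaloisGroup E) : W.geomTorsion ((p ^ J : ℕ) : ℤ)) :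
          W.geomPoints) = (τ : absoluteGaloisGroup E) • Q - Q := hτ τ
      rw [sub_eq_iff_eq_add] at e1
      rw [e1] at e2
      change pointsMap W E ((ξ.1 (resGal (K := K) E (τ : absoluteGaloisGroup E)) :
          W.geomTorsion ((p ^ J : ℕ) : ℤ)) : W.geomPoints) = _
      calc pointsMap W E ((ξ.1 (resGal (K := K) E (τ : absoluteGaloisGroup E)) :
              W.geomTorsion ((p ^ J : ℕ) : ℤ)) : W.geomPoints)
          = ((τ : absoluteGaloisGroup E) • Q - Q) -
              ((τ : absoluteGaloisGroup E) • pointsMap W E (m : W.geomPoints) - pointsMap W E (m : W.geomPoints)) := by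
            rw [← e2]; abel
        _ = _ := by rw [smul_sub]; abel

end WeierstrassCurve

end
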